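import Summits.HodgeConjecture.HodgeConjecture.Theorems.SiegelUniversalFamilyHodgeFrames
import Summits.HodgeConjecture.CorCM.HypDel.M1primeOfFU
import Summits.HodgeConjecture.CorCM.D2Bridge.ShimuraComponentMaps
import Literature.AlgebraicGeometry.ModuliOfAbelianVarieties.SiegelModuliTower
import HarnessLib

/-!
# E-road, Hecke-link socket (A): a THICK lift along the level-lowering map `tr` from «`tr` lifts relative dimension»

Cell hodgecm-mathlib (D-0151), E-road «EQUIDIM by proof» (skeleton `Cruxes/HDel/Lines/EquidimOfF.lean` v1.1, residual
`stub_noThinPiece`), Hecke-link line card v1.1, socket (A) `SocketThickLinkedLift` (B-p01 (g13) probe v2/v3), B-plan1 (g14)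
RULING 2026-08-29T19:31:36Z (1): TOWER typing retained, binder road = B-p01 (g13)'s (R4) «INFINITESIMAL» `TrLiftsRelDim`.
THEOREMS ONLY, `--as helper` capital for `stmt-HodgeConjecture-24835` (count-neutral).  HC_CM is proved only modulo the 7
printed citations until rung 0 closes.

## The mathematics

Let `𝓜 = (𝓜 K)_K` be a family of Siegel fine moduli schemes at the principal levels ([MumfordFogartyKirwan1994] Thm. 7.9,
[Deligne1971TravauxShimura] 4.16; (F) `lan2013_siegelFineModuliScheme` makes every `(𝓜 K).M` smooth and quasi-projective), and
`tr_f : (𝓜 K).M → (𝓜 K′).M` the level-lowering classifying map along `f : K ⟶ K′` (★ `SiegelModuliTower.tr`).  Suppose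
(i) `tr_f` is SURJECTIVE on `ℂ`-points (★ (P1) `SiegelModuliTower.exists_comp_tr_eq`, B-p14 (g14); taken as the hypothesis
`hP1` in its exact shape) and (ii) `tr_f` LIFTS RELATIVE DIMENSION (B-p01 (g13)'s binder `TrLiftsRelDim`, hypothesis `hLift`:
whenever a complex point `s″` of a smooth open piece of `(𝓜 K)_ℂ` of relative dimension `d″` maps under `tr_{f,ℂ}` to a complex
point `s` of a smooth open piece of `(𝓜 K′)_ℂ` of relative dimension `d`, then `d ≤ d″` — proved in (R4) from the lifting of
`ℂ[ε]`-points along `tr` and a cotangent count).  Then every complex point `s` of a piece of relative dimension `d₀` DOWNSTAIRS has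
a complex point `y` UPSTAIRS on an irreducible open-and-closed quasi-projective piece of relative dimension `d″ ≥ d₀` with
`tr_{f,ℂ}(y) = s` (`exists_lift_le_relDim`): lift the `ℚ`-morphism `Spec ℂ → (𝓜 K′).M` underlying `s` by (i), read the lift in
the finite clopen decomposition of `(𝓜 K)_ℂ` into smooth irreducible pieces (★ `UnivFamilyHodgeFrames.exists_smooth_pieces_baseChange_M`
/ ★ `exists_components_isColimit_of_smooth`), and apply (ii); the identification of `ℂ`-points of `(𝓜 K)_ℂ` with `ℚ`-morphisms
`Spec ℂ → (𝓜 K).M` is ★ `AlgPoints.baseChangeEquiv`, natural in the scheme (★ `D2Bridge.AlgPoints.baseChangeEquiv_map`,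
[GortzWedhorn2020] (4.7.1)).  With `d₀ = g(g+1)/2` (a THICK piece, brick H0 ★ `EquidimThickPiece.exists_openPiece_le`) the point
`y` is THICK ((c″) `isThickAt_iff_le`, B-p01 (g13)) — the «thick lift» half of `SocketThickLinkedLift`.

## References
* [MumfordFogartyKirwan1994] GIT 3rd ed., Ch. 7 §3 Thm. 7.9 (p. 139), Appendix 7A (p. 235) (the tower `𝒜_{g,d,nm} → 𝒜_{g,d,n}`).
* [Deligne1971TravauxShimura] 4.16–4.17 (p. 150).
* [GortzWedhorn2020] (4.7) eq. (4.7.1) (points of a base change); Thm. 6.28.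
-/

set_option autoImplicit false
set_option linter.dupNamespace false  -- `Summit.HodgeConjecture.HodgeConjecture.…` is the cell's layout (D-0017)

noncomputable section

open CategoryTheory CategoryTheory.Limits AlgebraicGeometry Set
open Literature.AlgebraicGeometry
open Literature.AlgebraicGeometry.Motives (SchemeOver ComplexPoints AlgPoints specOver)
open Literature.AlgebraicGeometry.HodgeTheory (IsQuasiProjectiveOver)
open Literature.AlgebraicGeometry.ModuliOfAbelianVarieties
open Literature.NumberTheory.Adeles
open Literature.AlgebraicTopology.SingularHomology (IsClopenPartition)

namespace Summit.HodgeConjecture.HodgeConjecture.Theorems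

namespace EquidimThickLift

open SiegelModuli SiegelModuliTower

variable {g : ℕ} {δ : Fin g → ℕ}

/-- **`ℂ`-POINTS OF `M_ℂ` LIFT ALONG `tr_ℂ` WHEN `ℚ`-MORPHISMS `Spec ℂ → M` LIFT ALONG `tr`** (the (P1) hypothesis read on complex
points through ★ `AlgPoints.baseChangeEquiv`, natural by ★ `D2Bridge.AlgPoints.baseChangeEquiv_map`).
[cite: GortzWedhorn2020, §(4.7) eq. (4.7.1)] [cite: MumfordFogartyKirwan1994, App. 7A (p. 235)] -/
theorem exists_map_tr_eq (hg : 0 < g) (𝓜 : ∀ K : SiegelLevel δ, SiegelFineModuliScheme g K.N δ) {K K' : SiegelLevel δ}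
    (f : K ⟶ K')
    (hP1 : ∀ x : specOver ℚ ℂ ⟶ (𝓜 K').M, ∃ y : specOver ℚ ℂ ⟶ (𝓜 K).M, y ≫ tr hg 𝓜 f = x)
    (s : ComplexPoints ((Motives.baseChange ℚ ℂ).obj (𝓜 K').M)) :
    ∃ y : ComplexPoints ((Motives.baseChange ℚ ℂ).obj (𝓜 K).M),
      AlgPoints.map ((Motives.baseChange ℚ ℂ).map (tr hg 𝓜 f)) y = s := by
  let bce' := AlgPoints.baseChangeEquiv (algebraMap ℚ ℂ) (𝓜 K').M
  let bce := AlgPoints.baseChangeEquiv (algebraMap ℚ ℂ) (𝓜 K).M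
  obtain ⟨y₀, hy₀⟩ := hP1 (bce'.symm s)
  refine ⟨bce y₀, ?_⟩
  have hnat := Summit.HodgeConjecture.CorCM.D2Bridge.AlgPoints.baseChangeEquiv_map (algebraMap ℚ ℂ) (tr hg 𝓜 f) y₀
  change bce' (AlgPoints.map (tr hg 𝓜 f) y₀) = AlgPoints.map ((Motives.baseChange ℚ ℂ).map (tr hg 𝓜 f)) (bce y₀) at hnat
  rw [← hnat, AlgPoints.map_apply, hy₀, Equiv.apply_symm_apply]

/-- **THE THICK LIFT (socket (A) of the Hecke link, B-plan1 (g14) ruling 19:31:36Z (1)).**  For a family `𝓜` of Siegel fine moduli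
schemes with (F), an arrow `f : K ⟶ K′` of levels, (P1) «`tr_f` is surjective on `ℂ`-points» (`hP1`, ★ `SiegelModuliTower.exists_comp_tr_eq`)
and (R4) «`tr_f` lifts relative dimension at `ℂ`-points» (`hLift` = B-p01 (g13)'s `TrLiftsRelDim` at `f`): every complex point `s`
of a smooth open piece `ι₀ : S₀ ⟶ (𝓜 K′)_ℂ` of relative dimension `d₀` is the image under `tr_{f,ℂ}` of a complex point `y` of an
IRREDUCIBLE OPEN-AND-CLOSED QUASI-PROJECTIVE piece `ι′ : S″ ⟶ (𝓜 K)_ℂ`, smooth of relative dimension `d″ ≥ d₀`.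
[cite: MumfordFogartyKirwan1994, App. 7A (p. 235)] [cite: GortzWedhorn2020, Thm. 6.28] -/
theorem exists_lift_le_relDim (hF : lan2013_siegelFineModuliScheme) (hg : 0 < g) (hδ : IsPolarizationType δ)
    (𝓜 : ∀ K : SiegelLevel δ, SiegelFineModuliScheme g K.N δ) {K K' : SiegelLevel δ} (f : K ⟶ K')
    (hP1 : ∀ x : specOver ℚ ℂ ⟶ (𝓜 K').M, ∃ y : specOver ℚ ℂ ⟶ (𝓜 K).M, y ≫ tr hg 𝓜 f = x)
    (hLift : ∀ {S'' S' : SchemeOver ℂ} (ι'' : S'' ⟶ (Motives.baseChange ℚ ℂ).obj (𝓜 K).M) [IsOpenImmersion ι''.left]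
      (d'' : ℕ) [SmoothOfRelativeDimension d'' S''.hom]
      (ι : S' ⟶ (Motives.baseChange ℚ ℂ).obj (𝓜 K').M) [IsOpenImmersion ι.left] (d : ℕ) [SmoothOfRelativeDimension d S'.hom]
      (s'' : ComplexPoints S'') (s : ComplexPoints S'),
      AlgPoints.map ((Motives.baseChange ℚ ℂ).map (tr hg 𝓜 f)) (AlgPoints.map ι'' s'') = AlgPoints.map ι s → d ≤ d'')
    {S₀ : SchemeOver ℂ} (ι₀ : S₀ ⟶ (Motives.baseChange ℚ ℂ).obj (𝓜 K').M) [IsOpenImmersion ι₀.left]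
    (d₀ : ℕ) [SmoothOfRelativeDimension d₀ S₀.hom] (s : ComplexPoints S₀) :
    ∃ (S'' : SchemeOver ℂ) (ι' : S'' ⟶ (Motives.baseChange ℚ ℂ).obj (𝓜 K).M) (_ : IsOpenImmersion ι'.left)
      (_ : IsClosedImmersion ι'.left) (_ : IsQuasiProjectiveOver S'') (d'' : ℕ) (_ : SmoothOfRelativeDimension d'' S''.hom)
      (y : ComplexPoints S''),
      d₀ ≤ d'' ∧ AlgPoints.map ((Motives.baseChange ℚ ℂ).map (tr hg 𝓜 f)) (AlgPoints.map ι' y) = AlgPoints.map ι₀ s := by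
  -- the lift of the complex point
  obtain ⟨y₁, hy₁⟩ := exists_map_tr_eq hg 𝓜 f hP1 (AlgPoints.map ι₀ s)
  -- the pieces of `(𝓜 K)_ℂ`
  obtain ⟨hMs, hMq, -⟩ := W1.smooth_qproj_of_F hF hg hδ K.three_le_N (𝓜 K)
  obtain ⟨C, hCfin, E, e, d, hopen, hclosed, hqp, hdim, hpart, -⟩ :=
    UnivFamilyHodgeFrames.exists_smooth_pieces_baseChange_M (𝓜 K) hMs hMq
  obtain ⟨c, y, hy⟩ := hpart.exists_mem y₁
  haveI := hopen c
  haveI := hdim c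
  refine ⟨E c, e c, hopen c, hclosed c, hqp c, d c, hdim c, y, ?_, ?_⟩
  · exact hLift (e c) (d c) ι₀ d₀ y s (by rw [hy, hy₁])
  · rw [hy, hy₁]

end EquidimThickLift

end Summit.HodgeConjecture.HodgeConjecture.Theorems

end
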